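import Summits.ValiantsHypothesis.ValiantsHypothesis.Theorems.LacunarySymmetroidMatrixDescartesOverlapWindow
import Summits.ValiantsHypothesis.ValiantsHypothesis.Theorems.LacunarySymmetroidMatrixDescartesStubArith4

/-!
# `MatrixDescartes` — the OVERLAP SECTOR: live-set covers of the positive axis, all real zeros, the crux inequality

HONEST FRAMING.  Object-search cell `pub-symmetroid`, crux `Theses.LacunarySymmetroid.MatrixDescartes` (ledger item
`stmt-ValiantsHypothesis-18050`, route `LacunarySymmetroid`; seat `val-sym-mdr-p2`, gen 13).  The crux implies `VP ≠ VNP`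
by the route's assembly; NOTHING here is progress on it, and nothing here is a claim about `VP ≠ VNP`, `DoorA26` /
`DoorA34` or the cell's registers.  Sequel of `…RobustDescartes` / `…OverlapWindow` (the robust Descartes rule and the
OVERLAP WINDOW LAW `Overlap.card_roots_Icc_le_of_liveSet`).

THE OVERLAP SECTOR (`card_posRoots_le_of_liveCover`).  Let `F = ∑ₗ X^(d l) • S l` be ANY real `m × m` lacunary pencil.
A LIVE-SET COVER is a chain `0 < p₀ ≤ p₁ ≤ ⋯ ≤ p_N` together with, for each window `[p_{j−1}, p_j]`, a live set `L j`, a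
survivor `t j ∈ L j` and a cut set `A j` (every live non-survivor exponent cut) carrying the endpoint certificate of the
window law at `p_{j−1}` and at `p_j`; below `p₀` the BOTTOM letter (strictly smallest exponent) and above `p_N` the TOP
letter (strictly largest exponent) dominate in the exact currency AT ONE POINT (`p₀`, resp. `p_N`), which propagates down
the ray `(0, p₀]`, resp. up `[p_N, ∞)`, by monotonicity of monomial ratios (`no_root_below_of_bot`, `no_root_above_of_top`).
THEN `Z₊ ≤ ∑ⱼ #(A j)` (`card_posRoots_le_of_liveCover`); the certificates are invariant under the reflection
`S l ↦ (−1)^(d l) S l` (`abs_det_rowChoice_reflect`), so ALL distinct real zeros number at most `2·∑ⱼ #(A j) + 1`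
(`card_realRoots_le_of_liveCover`, tree `stub_negRoots`).  With the canonical cuts, window `j` costs
`≤ C(#L j + m − 1, m) − 1` — Descartes of its live sub-pencil: `0` for a single live letter, `m` for two (a hand-over),
`m(m+3)/2` for three, …; the letter-separated sector of gen 12 is the case `#L j ≤ 2`.
THE CRUX INEQUALITY ON THE SECTOR (`overlapSector_mdr`).  In the crux's regime `m ≤ 2^((⌊log₂K⌋+c)^c)`, every real pencil
(symmetric or not) admitting a live-set cover with `N ≤ K` windows of cut budget `#(A j) ≤ (m + w)^w` each (`w` fixed;
e.g. live widths `#L j ≤ w + 1` with canonical cuts) satisfies `Z^q ≤ 2^(K⌊log₂K⌋)` for `K ≥ K₀(c, q, w)`.  READING: a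
pencil violating `MatrixDescartes` in its own size window must, at some scale `x`, have MORE than a bounded number of
letters simultaneously live (within the weighted margin of the dominant one) — the monsters live where many letters
overlap, not in any hierarchical / scale-separated design.  A SECTOR theorem: nothing is claimed about wide overlaps, where
all the difficulty of the crux lies (there the window count is Descartes' and symmetric structure would have to matter).
[folklore] (Laguerre's method; monotone transport; counting).
-/

-- `Summit.ValiantsHypothesis.ValiantsHypothesis.…` repeats a component by the D-0017 layout (single-conjunct summit).
set_option linter.dupNamespace false

namespace Summit.ValiantsHypothesis.ValiantsHypothesis.Theorems.LacunarySymmetroidMatrixDescartes.Overlap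

open Polynomial Finset Set
open scoped BigOperators Matrix

variable {K m : ℕ}

/-! ## §6 Monotone transport with an arbitrary index set; the two rays -/

/-- **Monotone transport below (arbitrary index).**  If every exponent is `≥ a`, a strict dominance `∑ w i·x^(e i) < B·x^a`
at `p` persists on `(0, p]` (tree `KPlusLogSqLaw.ExactPatchwork.sum_mul_pow_lt_of_le_of_forall_le`, regrouped by exponent).
[folklore] -/
theorem sum_mul_pow_lt_below {ι : Type*} (s : Finset ι) (w : ι → ℝ) (hw : ∀ i ∈ s, 0 ≤ w i) (e : ι → ℕ) (a : ℕ)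
    (hS : ∀ i ∈ s, a ≤ e i) {B p x : ℝ} (hx : 0 < x) (hxp : x ≤ p)
    (h1 : ∑ i ∈ s, w i * p ^ (e i) < B * p ^ a) : ∑ i ∈ s, w i * x ^ (e i) < B * x ^ a := by
  classical
  rw [RobustDescartes.sum_mul_pow_eq_sum_image] at h1 ⊢
  refine KPlusLogSqLaw.ExactPatchwork.sum_mul_pow_lt_of_le_of_forall_le (s.image e)
    (fun n => ∑ i ∈ s.filter (fun i => e i = n), w i)
    (fun n => Finset.sum_nonneg fun i hi => hw i (Finset.mem_filter.1 hi).1) a (fun n hn => ?_) hx hxp h1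
  obtain ⟨i, hi, rfl⟩ := Finset.mem_image.1 hn
  exact hS i hi

/-- **Monotone transport above (arbitrary index).**  If every exponent is `≤ a`, a strict dominance at `q` persists on
`[q, ∞)`. [folklore] -/
theorem sum_mul_pow_lt_above {ι : Type*} (s : Finset ι) (w : ι → ℝ) (hw : ∀ i ∈ s, 0 ≤ w i) (e : ι → ℕ) (a : ℕ)
    (hS : ∀ i ∈ s, e i ≤ a) {B q x : ℝ} (hq : 0 < q) (hqx : q ≤ x)
    (h1 : ∑ i ∈ s, w i * q ^ (e i) < B * q ^ a) : ∑ i ∈ s, w i * x ^ (e i) < B * x ^ a := by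
  classical
  rw [RobustDescartes.sum_mul_pow_eq_sum_image] at h1 ⊢
  refine KPlusLogSqLaw.ExactPatchwork.sum_mul_pow_lt_of_ge_of_forall_ge (s.image e)
    (fun n => ∑ i ∈ s.filter (fun i => e i = n), w i)
    (fun n => Finset.sum_nonneg fun i hi => hw i (Finset.mem_filter.1 hi).1) a (fun n hn => ?_) hq hqx h1
  obtain ⟨i, hi, rfl⟩ := Finset.mem_image.1 hn
  exact hS i hi

/-- **Point certificate with a surviving INDEX.**  If at `x ≥ 0` one monomial `c i₀·x^(e i₀)` beats the absolute mass of
all the others, the sum does not vanish at `x`. [folklore] -/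
theorem eval_ne_zero_of_index {ι : Type*} [DecidableEq ι] (s : Finset ι) (c : ι → ℝ) (e : ι → ℕ) (i₀ : ι)
    (hi₀ : i₀ ∈ s) {x : ℝ} (hx : 0 ≤ x)
    (h : ∑ i ∈ s.erase i₀, |c i| * x ^ (e i) < |c i₀| * x ^ (e i₀)) :
    (∑ i ∈ s, C (c i) * X ^ (e i)).eval x ≠ 0 := by
  rw [RobustDescartes.eval_sum_C_mul_X_pow, ← Finset.add_sum_erase s _ hi₀]
  have htail : |∑ i ∈ s.erase i₀, c i * x ^ (e i)| ≤ ∑ i ∈ s.erase i₀, |c i| * x ^ (e i) := by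
    refine (Finset.abs_sum_le_sum_abs _ _).trans (le_of_eq (Finset.sum_congr rfl fun i _ => ?_))
    rw [abs_mul, abs_of_nonneg (pow_nonneg hx _)]
  intro h0
  have h3 : c i₀ * x ^ (e i₀) = -(∑ i ∈ s.erase i₀, c i * x ^ (e i)) := by linarith
  have h4 : |c i₀ * x ^ (e i₀)| ≤ ∑ i ∈ s.erase i₀, |c i| * x ^ (e i) := by
    rw [h3, abs_neg]; exact htail
  rw [abs_mul, abs_of_nonneg (pow_nonneg hx _)] at h4
  linarith

/-- **Single dominant letter at one point ⇒ no zero there (exact currency).**  If at `x > 0`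
`∑_{f ≠ const l₀} |det N_f|·x^(e f) < |det S l₀|·x^(m·d l₀)`, then `det F(x) ≠ 0`. [folklore] -/
theorem not_isRoot_of_single (d : Fin K → ℕ) (S : Fin K → Matrix (Fin m) (Fin m) ℝ) (l₀ : Fin K) {x : ℝ} (hx : 0 < x)
    (hdom : ∑ f ∈ Finset.univ.erase (fun _ : Fin m => l₀),
        |Matrix.det (Matrix.of fun i j => S (f i) i j)| * x ^ (∑ i, d (f i)) < |(S l₀).det| * x ^ (m * d l₀)) :
    ¬ (Matrix.det (∑ l, ((X : ℝ[X]) ^ d l) • (S l).map C)).IsRoot x := by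
  classical
  intro hroot
  rw [IsRoot.def, det_pencil_eq_sum_C_mul_X_pow] at hroot
  refine eval_ne_zero_of_index (Finset.univ : Finset (Fin m → Fin K))
    (fun f => Matrix.det (Matrix.of fun i j => S (f i) i j)) (fun f => ∑ i, d (f i)) (fun _ => l₀)
    (Finset.mem_univ _) hx.le ?_ hroot
  have hN : (Matrix.of fun i j => S ((fun _ : Fin m => l₀) i) i j) = S l₀ := by ext i j; rfl
  have he : (∑ i : Fin m, d ((fun _ : Fin m => l₀) i)) = m * d l₀ := by
    rw [Finset.sum_const, Finset.card_univ, Fintype.card_fin, smul_eq_mul]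
  simp only [hN, he]
  exact hdom

/-- **Bottom ray.**  If `b` has strictly the smallest exponent and dominates in the exact currency at `p > 0`, then
`det F` has no zero in `(0, p]`: every other row-choice exponent is `≥ m·d b`, so the dominance propagates downwards
(`sum_mul_pow_lt_below`). [folklore] -/
theorem no_root_below_of_bot (d : Fin K → ℕ) (S : Fin K → Matrix (Fin m) (Fin m) ℝ) (b : Fin K)
    (hb : ∀ l, l ≠ b → d b < d l) {p : ℝ}
    (hdom : ∑ f ∈ Finset.univ.erase (fun _ : Fin m => b),
        |Matrix.det (Matrix.of fun i j => S (f i) i j)| * p ^ (∑ i, d (f i)) < |(S b).det| * p ^ (m * d b))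
    {x : ℝ} (hx : 0 < x) (hxp : x ≤ p) :
    ¬ (Matrix.det (∑ l, ((X : ℝ[X]) ^ d l) • (S l).map C)).IsRoot x := by
  classical
  refine not_isRoot_of_single d S b hx (sum_mul_pow_lt_below _ _ (fun f _ => abs_nonneg _) _ (m * d b)
    (fun f _ => ?_) hx hxp hdom)
  have hle : ∀ i, d b ≤ d (f i) := fun i => by
    by_cases h : f i = b
    · rw [h]
    · exact (hb _ h).le
  calc m * d b = ∑ _i : Fin m, d b := by rw [Finset.sum_const, Finset.card_univ, Fintype.card_fin, smul_eq_mul]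
    _ ≤ ∑ i, d (f i) := Finset.sum_le_sum fun i _ => hle i

/-- **Top ray.**  If `τ` has strictly the largest exponent and dominates in the exact currency at `q > 0`, then `det F`
has no zero in `[q, ∞)` (`sum_mul_pow_lt_above`). [folklore] -/
theorem no_root_above_of_top (d : Fin K → ℕ) (S : Fin K → Matrix (Fin m) (Fin m) ℝ) (τ : Fin K)
    (hτ : ∀ l, l ≠ τ → d l < d τ) {q : ℝ} (hq : 0 < q)
    (hdom : ∑ f ∈ Finset.univ.erase (fun _ : Fin m => τ),
        |Matrix.det (Matrix.of fun i j => S (f i) i j)| * q ^ (∑ i, d (f i)) < |(S τ).det| * q ^ (m * d τ))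
    {x : ℝ} (hqx : q ≤ x) :
    ¬ (Matrix.det (∑ l, ((X : ℝ[X]) ^ d l) • (S l).map C)).IsRoot x := by
  classical
  refine not_isRoot_of_single d S τ (hq.trans_le hqx) (sum_mul_pow_lt_above _ _ (fun f _ => abs_nonneg _) _
    (m * d τ) (fun f _ => ?_) hq hqx hdom)
  have hle : ∀ i, d (f i) ≤ d τ := fun i => by
    by_cases h : f i = τ
    · rw [h]
    · exact (hτ _ h).le
  calc ∑ i, d (f i) ≤ ∑ _i : Fin m, d τ := Finset.sum_le_sum fun i _ => hle i
    _ = m * d τ := by rw [Finset.sum_const, Finset.card_univ, Fintype.card_fin, smul_eq_mul]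

/-! ## §7 Assembly: live-set covers of the positive axis -/

/-- **Locating a point in a monotone chain.**  For `p : Fin (N+1) → ℝ` monotone and `p 0 < x < p (last N)`, some window
`[p j.castSucc, p j.succ]` contains `x`. [folklore] -/
theorem exists_window_of_chain {N : ℕ} (p : Fin (N + 1) → ℝ) {x : ℝ} (h0 : p 0 ≤ x) (hN : x < p (Fin.last N)) :
    ∃ j : Fin N, p j.castSucc ≤ x ∧ x ≤ p j.succ := by
  classical
  set J : Finset (Fin (N + 1)) := Finset.univ.filter (fun k => p k ≤ x) with hJ
  have hJne : J.Nonempty := ⟨0, by rw [hJ, Finset.mem_filter]; exact ⟨Finset.mem_univ _, h0⟩⟩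
  set k := J.max' hJne with hk
  have hkJ : k ∈ J := Finset.max'_mem J hJne
  rw [hJ, Finset.mem_filter] at hkJ
  have hklast : k ≠ Fin.last N := fun h => by rw [h] at hkJ; exact absurd hkJ.2 (not_le.2 hN)
  have hklt : k.val < N := by
    have := k.isLt
    rcases Nat.lt_succ_iff_lt_or_eq.1 this with h | h
    · exact h
    · exact absurd (Fin.ext h) hklast
  refine ⟨⟨k.val, hklt⟩, ?_, ?_⟩
  · have : (⟨k.val, hklt⟩ : Fin N).castSucc = k := Fin.ext rfl
    rw [this]; exact hkJ.2
  · by_contra hcon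
    rw [not_le] at hcon
    have hmem : (⟨k.val, hklt⟩ : Fin N).succ ∈ J := by
      rw [hJ, Finset.mem_filter]; exact ⟨Finset.mem_univ _, hcon.le⟩
    have hle := Finset.le_max' J _ hmem
    rw [← hk] at hle
    have : k.val + 1 ≤ k.val := hle
    omega

/-- **OVERLAP SECTOR (positive zeros).**  A LIVE-SET COVER of the positive axis — a monotone chain
`0 < p 0 ≤ ⋯ ≤ p N`, windows `[p j.castSucc, p j.succ]` with live sets `L j`, survivors `t j ∈ L j`, cut sets `A j` (every
live non-survivor exponent cut) and the endpoint certificates of the window law (`…OverlapWindow`), plus exact single-letter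
dominance of the bottom letter `b` at `p 0` and of the top letter `τ` at `p N` — gives `Z₊ ≤ ∑ⱼ #(A j)`.  ANY real
letters. [folklore] -/
theorem card_posRoots_le_of_liveCover (d : Fin K → ℕ) (S : Fin K → Matrix (Fin m) (Fin m) ℝ) {N : ℕ}
    (p : Fin (N + 1) → ℝ) (hp0 : 0 < p 0) (hmono : Monotone p)
    (L : Fin N → Finset (Fin K)) (t : Fin N → Fin K) (ht : ∀ j, t j ∈ L j) (A : Fin N → Finset ℕ)
    (hA : ∀ j, ∀ f : Fin m → Fin K, (∀ i, f i ∈ L j) → (∃ i, f i ≠ t j) → (∑ i, d (f i)) ∈ A j)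
    (hwin : ∀ j, ∀ x : ℝ, (x = p j.castSucc ∨ x = p j.succ) →
      ∑ f ∈ Finset.univ.filter (fun f : Fin m → Fin K => ¬ ∀ i, f i ∈ L j),
        (∏ a ∈ A j, |((∑ i, d (f i) : ℕ) : ℝ) - a|) * |Matrix.det (Matrix.of fun i j => S (f i) i j)| *
          x ^ (∑ i, d (f i))
      < (∏ a ∈ A j, |((m * d (t j) : ℕ) : ℝ) - a|) * |(S (t j)).det| * x ^ (m * d (t j)))
    (b τ : Fin K) (hb : ∀ l, l ≠ b → d b < d l) (hτ : ∀ l, l ≠ τ → d l < d τ)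
    (hbot : ∑ f ∈ Finset.univ.erase (fun _ : Fin m => b),
        |Matrix.det (Matrix.of fun i j => S (f i) i j)| * (p 0) ^ (∑ i, d (f i)) < |(S b).det| * (p 0) ^ (m * d b))
    (htop : ∑ f ∈ Finset.univ.erase (fun _ : Fin m => τ),
        |Matrix.det (Matrix.of fun i j => S (f i) i j)| * (p (Fin.last N)) ^ (∑ i, d (f i))
        < |(S τ).det| * (p (Fin.last N)) ^ (m * d τ)) :
    ((Matrix.det (∑ l, ((X : ℝ[X]) ^ d l) • (S l).map C)).roots.toFinset.filter (fun x => 0 < x)).card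
      ≤ ∑ j, (A j).card := by
  classical
  set F : ℝ[X] := Matrix.det (∑ l, ((X : ℝ[X]) ^ d l) • (S l).map C) with hFdef
  by_cases hF0 : F = 0
  · rw [hF0, roots_zero, Multiset.toFinset_zero, Finset.filter_empty, Finset.card_empty]; exact Nat.zero_le _
  have hsub : F.roots.toFinset.filter (fun x => 0 < x) ⊆
      (Finset.univ : Finset (Fin N)).biUnion
        (fun j => F.roots.toFinset.filter (fun x => x ∈ Icc (p j.castSucc) (p j.succ))) := by
    intro x hx
    rw [Finset.mem_filter, Multiset.mem_toFinset, mem_roots hF0] at hx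
    rcases le_or_gt x (p 0) with h0 | h0
    · exact absurd hx.1 (no_root_below_of_bot d S b hb hbot hx.2 h0)
    rcases le_or_gt (p (Fin.last N)) x with hN | hN
    · exact absurd hx.1 (no_root_above_of_top d S τ hτ (hp0.trans_le (hmono (Fin.zero_le _))) htop hN)
    obtain ⟨j, hj1, hj2⟩ := exists_window_of_chain p h0.le hN
    rw [Finset.mem_biUnion]
    refine ⟨j, Finset.mem_univ _, ?_⟩
    rw [Finset.mem_filter, Multiset.mem_toFinset, mem_roots hF0]
    exact ⟨hx.1, hj1, hj2⟩
  calc (F.roots.toFinset.filter (fun x => 0 < x)).card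
      ≤ ((Finset.univ : Finset (Fin N)).biUnion
          (fun j => F.roots.toFinset.filter (fun x => x ∈ Icc (p j.castSucc) (p j.succ)))).card :=
        Finset.card_le_card hsub
    _ ≤ ∑ j, (F.roots.toFinset.filter (fun x => x ∈ Icc (p j.castSucc) (p j.succ))).card :=
        Finset.card_biUnion_le
    _ ≤ ∑ j, (A j).card := Finset.sum_le_sum fun j _ =>
        card_roots_Icc_le_of_liveSet d S (L j) (t j) (ht j) (A j) (hA j)
          (hp0.trans_le (hmono (Fin.zero_le _))) (hmono (Fin.castSucc_le_succ j))
          (hwin j _ (Or.inl rfl)) (hwin j _ (Or.inr rfl))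

/-! ## §8 All real zeros (reflection) and the crux inequality on the sector -/

/-- The row-choice determinants of the reflected pencil `S l ↦ (−1)^(d l) S l` have the same absolute values (row `i` is
multiplied by `±1`; `Matrix.det_mul_column`). [folklore] -/
theorem abs_det_rowChoice_reflect (d : Fin K → ℕ) (S : Fin K → Matrix (Fin m) (Fin m) ℝ) (f : Fin m → Fin K) :
    |Matrix.det (Matrix.of fun i j => (((-1 : ℝ) ^ d (f i)) • S (f i)) i j)| =
      |Matrix.det (Matrix.of fun i j => S (f i) i j)| := by
  have h : (Matrix.of fun i j => (((-1 : ℝ) ^ d (f i)) • S (f i)) i j) =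
      Matrix.of fun i j => ((-1 : ℝ) ^ d (f i)) * (Matrix.of fun i j => S (f i) i j) i j := by
    ext i j; simp [Matrix.smul_apply]
  rw [h, Matrix.det_mul_column, abs_mul, Finset.abs_prod]
  have h1 : ∏ i : Fin m, |(-1 : ℝ) ^ d (f i)| = 1 := Finset.prod_eq_one fun i _ => by
    rw [abs_pow, abs_neg, abs_one, one_pow]
  rw [h1, one_mul]

/-- The reflected letters have the same `|det|`. [folklore] -/
theorem abs_det_reflect (d : Fin K → ℕ) (S : Fin K → Matrix (Fin m) (Fin m) ℝ) (l : Fin K) :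
    |(((-1 : ℝ) ^ d l) • S l).det| = |(S l).det| := by
  rw [Matrix.det_smul, abs_mul, abs_pow, abs_pow, abs_neg, abs_one, one_pow, one_pow, one_mul]

/-- **OVERLAP SECTOR (all real zeros).**  Under the hypotheses of `card_posRoots_le_of_liveCover` the number of ALL distinct
real zeros of `det F` is at most `2·∑ⱼ #(A j) + 1`: the certificates only involve `|det N_f|` and `|det S l|`, which are
invariant under the reflection `S l ↦ (−1)^(d l) S l` counting the negative zeros (tree `stub_negRoots`). [folklore] -/
theorem card_realRoots_le_of_liveCover (d : Fin K → ℕ) (S : Fin K → Matrix (Fin m) (Fin m) ℝ) {N : ℕ}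
    (p : Fin (N + 1) → ℝ) (hp0 : 0 < p 0) (hmono : Monotone p)
    (L : Fin N → Finset (Fin K)) (t : Fin N → Fin K) (ht : ∀ j, t j ∈ L j) (A : Fin N → Finset ℕ)
    (hA : ∀ j, ∀ f : Fin m → Fin K, (∀ i, f i ∈ L j) → (∃ i, f i ≠ t j) → (∑ i, d (f i)) ∈ A j)
    (hwin : ∀ j, ∀ x : ℝ, (x = p j.castSucc ∨ x = p j.succ) →
      ∑ f ∈ Finset.univ.filter (fun f : Fin m → Fin K => ¬ ∀ i, f i ∈ L j),
        (∏ a ∈ A j, |((∑ i, d (f i) : ℕ) : ℝ) - a|) * |Matrix.det (Matrix.of fun i j => S (f i) i j)| *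
          x ^ (∑ i, d (f i))
      < (∏ a ∈ A j, |((m * d (t j) : ℕ) : ℝ) - a|) * |(S (t j)).det| * x ^ (m * d (t j)))
    (b τ : Fin K) (hb : ∀ l, l ≠ b → d b < d l) (hτ : ∀ l, l ≠ τ → d l < d τ)
    (hbot : ∑ f ∈ Finset.univ.erase (fun _ : Fin m => b),
        |Matrix.det (Matrix.of fun i j => S (f i) i j)| * (p 0) ^ (∑ i, d (f i)) < |(S b).det| * (p 0) ^ (m * d b))
    (htop : ∑ f ∈ Finset.univ.erase (fun _ : Fin m => τ),
        |Matrix.det (Matrix.of fun i j => S (f i) i j)| * (p (Fin.last N)) ^ (∑ i, d (f i))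
        < |(S τ).det| * (p (Fin.last N)) ^ (m * d τ)) :
    (Matrix.det (∑ l, ((X : ℝ[X]) ^ d l) • (S l).map C)).roots.toFinset.card ≤ 2 * ∑ j, (A j).card + 1 := by
  classical
  have h1 := card_posRoots_le_of_liveCover d S p hp0 hmono L t ht A hA hwin b τ hb hτ hbot htop
  have h2 := card_posRoots_le_of_liveCover d (fun l => ((-1 : ℝ) ^ d l) • S l) p hp0 hmono L t ht A hA
    (fun j x hx => by simpa only [abs_det_rowChoice_reflect, abs_det_reflect] using hwin j x hx) b τ hb hτ
    (by simpa only [abs_det_rowChoice_reflect, abs_det_reflect] using hbot)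
    (by simpa only [abs_det_rowChoice_reflect, abs_det_reflect] using htop)
  have h3 := stub_negRoots K m d S
  omega

/-- **Regime arithmetic of the sector.**  In the crux's regime `m ≤ 2^((⌊log₂K⌋+c)^c)` a count `Z ≤ 2K(m+w)^w + 1`
satisfies `Z^q ≤ 2^(K⌊log₂K⌋)` for `K ≥ K₀(c, q, w)` (`Z ≤ 2^((⌊log₂K⌋ + (c+w+3))^(c+w+3))`, absorbed by the tree's
`stub_arith4`). [folklore] -/
theorem sector_absorb (c q w : ℕ) : ∃ K₀ : ℕ, ∀ K m Z : ℕ, K₀ ≤ K → m ≤ 2 ^ ((Nat.log 2 K + c) ^ c) →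
    Z ≤ 2 * (K * (m + w) ^ w) + 1 → Z ^ q ≤ 2 ^ (K * Nat.log 2 K) := by
  obtain ⟨K₁, hK₁⟩ := stub_arith4 (c + w + 3) q
  refine ⟨K₁, fun K m Z hK hm hZ => hK₁ K Z hK ?_⟩
  set Lg := Nat.log 2 K with hLg
  set B := Lg + (c + w + 3) with hB
  -- (1) `2K + 1 ≤ 2^(Lg+2)`
  have hK2 : K < 2 ^ (Lg + 1) := Nat.lt_pow_succ_log_self one_lt_two K
  have h2K : 2 * K + 1 ≤ 2 ^ (Lg + 2) := by rw [pow_succ]; omega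
  -- (2) `(m + w)^w ≤ 2^(w * ((Lg + c)^c + w))`
  have hmw : m + w ≤ 2 ^ ((Lg + c) ^ c + w) := by
    have ha : 1 ≤ 2 ^ ((Lg + c) ^ c) := Nat.one_le_two_pow
    have hw : w + 1 ≤ 2 ^ w := Nat.lt_two_pow_self
    calc m + w ≤ 2 ^ ((Lg + c) ^ c) + w := Nat.add_le_add_right hm w
      _ ≤ 2 ^ ((Lg + c) ^ c) * (w + 1) := by nlinarith
      _ ≤ 2 ^ ((Lg + c) ^ c) * 2 ^ w := Nat.mul_le_mul_left _ hw
      _ = 2 ^ ((Lg + c) ^ c + w) := by rw [← pow_add]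
  have hpow : (m + w) ^ w ≤ 2 ^ (w * ((Lg + c) ^ c + w)) := by
    calc (m + w) ^ w ≤ (2 ^ ((Lg + c) ^ c + w)) ^ w := Nat.pow_le_pow_left hmw w
      _ = 2 ^ (w * ((Lg + c) ^ c + w)) := by rw [← pow_mul, mul_comm]
  have h1pow : 1 ≤ (m + w) ^ w := by
    rcases Nat.eq_zero_or_pos w with hw | hw
    · rw [hw, pow_zero]
    · exact Nat.one_le_pow _ _ (by omega)
  -- (3) `Z ≤ 2^(Lg + 2 + w((Lg+c)^c + w))`
  have hZ' : Z ≤ 2 ^ (Lg + 2 + w * ((Lg + c) ^ c + w)) := by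
    calc Z ≤ 2 * (K * (m + w) ^ w) + 1 := hZ
      _ ≤ (2 * K + 1) * (m + w) ^ w := by nlinarith
      _ ≤ 2 ^ (Lg + 2) * 2 ^ (w * ((Lg + c) ^ c + w)) := Nat.mul_le_mul h2K hpow
      _ = 2 ^ (Lg + 2 + w * ((Lg + c) ^ c + w)) := by rw [← pow_add]
  -- (4) the exponent is at most `B^(c+w+3)`
  have hB3 : 3 ≤ B := by omega
  have hB1 : 1 ≤ B := by omega
  have hE1 : Lg + 2 ≤ B ^ (c + w + 2) := (by omega : Lg + 2 ≤ B).trans (Nat.le_self_pow (by omega) B)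
  have hE2 : w * (Lg + c) ^ c ≤ B ^ (c + w + 2) := by
    have hwB : w ≤ B := by omega
    have hc : (Lg + c) ^ c ≤ B ^ (c + w + 1) :=
      (Nat.pow_le_pow_left (by omega) c).trans (Nat.pow_le_pow_right hB1 (by omega))
    calc w * (Lg + c) ^ c ≤ B * B ^ (c + w + 1) := Nat.mul_le_mul hwB hc
      _ = B ^ (c + w + 2) := by rw [← pow_succ']
  have hE3 : w * w ≤ B ^ (c + w + 2) := by
    have hwB : w ≤ B := by omega
    calc w * w ≤ B * B := Nat.mul_le_mul hwB hwB
      _ = B ^ 2 := (pow_two B).symm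
      _ ≤ B ^ (c + w + 2) := Nat.pow_le_pow_right hB1 (by omega)
  have hE : Lg + 2 + w * ((Lg + c) ^ c + w) ≤ B ^ (c + w + 3) := by
    calc Lg + 2 + w * ((Lg + c) ^ c + w) = (Lg + 2) + w * (Lg + c) ^ c + w * w := by ring
      _ ≤ B ^ (c + w + 2) + B ^ (c + w + 2) + B ^ (c + w + 2) := by omega
      _ = 3 * B ^ (c + w + 2) := by ring
      _ ≤ B * B ^ (c + w + 2) := Nat.mul_le_mul_right _ hB3
      _ = B ^ (c + w + 3) := by rw [← pow_succ']
  calc Z ≤ 2 ^ (Lg + 2 + w * ((Lg + c) ^ c + w)) := hZ'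
    _ ≤ 2 ^ (B ^ (c + w + 3)) := Nat.pow_le_pow_right (by norm_num) hE
    _ = 2 ^ ((Nat.log 2 K + (c + w + 3)) ^ (c + w + 3)) := by rw [hB, hLg]

/-- **The crux's inequality on the OVERLAP SECTOR, at all fat formats.**  For all `c, q, w` there is `K₀` such that for
`K ≥ K₀`, `m ≤ 2^((⌊log₂K⌋+c)^c)` and EVERY real `m × m` lacunary pencil (symmetric or not) admitting a live-set cover
(`card_posRoots_le_of_liveCover`) with `N ≤ K` windows of cut budget `#(A j) ≤ (m + w)^w` each — e.g. live sets of at most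
`w + 1` letters with the canonical cuts, `C(#L + m − 1, m) − 1 ≤ (m + w)^w` — the number `Z` of distinct real zeros of
`det F` satisfies `Z^q ≤ 2^(K⌊log₂K⌋)`, the inequality of `MatrixDescartes` on this sector.  Reading: a pencil violating the
crux in its own size window has, at some scale, more than `w + 1` letters simultaneously live (in the weighted sense) for
every fixed `w` — eventually in `K`.  Nothing is claimed about such wide overlaps. [folklore] -/
theorem overlapSector_mdr (c q w : ℕ) : ∃ K₀ : ℕ, ∀ K m : ℕ, K₀ ≤ K → m ≤ 2 ^ ((Nat.log 2 K + c) ^ c) →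
    ∀ (d : Fin K → ℕ) (S : Fin K → Matrix (Fin m) (Fin m) ℝ) (N : ℕ) (p : Fin (N + 1) → ℝ),
      0 < p 0 → Monotone p →
    ∀ (L : Fin N → Finset (Fin K)) (t : Fin N → Fin K) (A : Fin N → Finset ℕ), (∀ j, t j ∈ L j) →
      (∀ j, ∀ f : Fin m → Fin K, (∀ i, f i ∈ L j) → (∃ i, f i ≠ t j) → (∑ i, d (f i)) ∈ A j) →
      (∀ j, ∀ x : ℝ, (x = p j.castSucc ∨ x = p j.succ) →
        ∑ f ∈ Finset.univ.filter (fun f : Fin m → Fin K => ¬ ∀ i, f i ∈ L j),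
          (∏ a ∈ A j, |((∑ i, d (f i) : ℕ) : ℝ) - a|) * |Matrix.det (Matrix.of fun i j => S (f i) i j)| *
            x ^ (∑ i, d (f i))
        < (∏ a ∈ A j, |((m * d (t j) : ℕ) : ℝ) - a|) * |(S (t j)).det| * x ^ (m * d (t j))) →
    ∀ (b τ : Fin K), (∀ l, l ≠ b → d b < d l) → (∀ l, l ≠ τ → d l < d τ) →
      (∑ f ∈ Finset.univ.erase (fun _ : Fin m => b),
        |Matrix.det (Matrix.of fun i j => S (f i) i j)| * (p 0) ^ (∑ i, d (f i)) < |(S b).det| * (p 0) ^ (m * d b)) →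
      (∑ f ∈ Finset.univ.erase (fun _ : Fin m => τ),
        |Matrix.det (Matrix.of fun i j => S (f i) i j)| * (p (Fin.last N)) ^ (∑ i, d (f i))
        < |(S τ).det| * (p (Fin.last N)) ^ (m * d τ)) →
      N ≤ K → (∀ j, (A j).card ≤ (m + w) ^ w) →
      (Matrix.det (∑ l, ((X : ℝ[X]) ^ d l) • (S l).map C)).roots.toFinset.card ^ q ≤ 2 ^ (K * Nat.log 2 K) := by
  obtain ⟨K₀, hK₀⟩ := sector_absorb c q w
  refine ⟨K₀, fun K m hK hm d S N p hp0 hmono L t A ht hA hwin b τ hb hτ hbot htop hN hAcard => hK₀ K m _ hK hm ?_⟩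
  have h := card_realRoots_le_of_liveCover d S p hp0 hmono L t ht A hA hwin b τ hb hτ hbot htop
  have hsum : ∑ j, (A j).card ≤ N * (m + w) ^ w := by
    calc ∑ j, (A j).card ≤ ∑ _j : Fin N, (m + w) ^ w := Finset.sum_le_sum fun j _ => hAcard j
      _ = N * (m + w) ^ w := by rw [Finset.sum_const, Finset.card_univ, Fintype.card_fin, smul_eq_mul]
  have hNK : N * (m + w) ^ w ≤ K * (m + w) ^ w := Nat.mul_le_mul_right _ hN
  omega

end Summit.ValiantsHypothesis.ValiantsHypothesis.Theorems.LacunarySymmetroidMatrixDescartes.Overlap
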